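import Summits.Ventures.DiscreteObjects.PP12.OrderElevenTriangleWalkSound
import Summits.Ventures.DiscreteObjects.PP12.OrderElevenTriangleLabelSound

/-!
# PP(12), order-11 cell, Case B (`NoTriangleData12`): the partition walker lists the blocks of every orbit (designs g23)
Framing: lottery ticket; floor = certified bounds/negative ranges.

Cell pub-namedobj (venture DiscreteObjects), target (M). Main induction over the fuel of `pgo` (`OrderElevenTriangleKernel`) along the true path described
by `PInv` (`OrderElevenTriangleWalkSound`): **`pgo_good`** and **`exists_blocks`** — for data satisfying (K0) and (D) on the orbit `s`, some
`bl ∈ partsEnum` is `GoodBlocks D s bl` (the non-empty blocks `E_{s,t}`, each exactly once); with the label walker's soundness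
(`OrderElevenTriangleLabelSound`): **`rowCode_mem_rowsFrom`** — every row of valid data is listed by `rowsFrom (packPhi D.phi) partsEnum`.
Proofs only; no `sorry`, no new axioms.
-/

set_option maxRecDepth 100000

namespace Summit.Ventures.DiscreteObjects.PP12

namespace Triangle12

open Function
open Fin.CommRing -- `Fin 11` as a commutative ring (scoped Mathlib instance): cyclic residue arithmetic

variable {D : TriangleData 11} {s : Fin 11}

/-- **the main induction**: from any true-path state the walker emits a good block list -/
theorem pgo_good (hK0 : D.PartitionOK s (fun _ => 0) 0) (hI : D.InternalOK s) :
    ∀ (f : ℕ) (t₀ : Fin 11) (top : ℕ) (CL : Finset (Fin 11)) (U Dm cur sz : ℕ) (blocks : List ℕ),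
      PInv D s t₀ top CL U Dm cur blocks → ucard U < f → ∃ bl ∈ pgo f U Dm cur sz top blocks, GoodBlocks D s bl
  | 0, _, _, _, _, _, _, _, _, _, hc => by omega
  | f + 1, t₀, top, CL, U, Dm, cur, sz, blocks, h, hc => by
    have htop11 := h.htop.1
    have hmt : D.mem s t₀ ⟨top, htop11⟩ = true := by rw [← memN_val]; exact h.htop.2
    rw [pgo]
    by_cases hR : ∃ e, top < e ∧ e < 11 ∧ memN D s t₀.val e = true
    · ----------------------------------------------------------------- extend the current block by its least element above `top`
      let y := Nat.find hR
      obtain ⟨hty, hy11, hmy⟩ : top < y ∧ y < 11 ∧ memN D s t₀.val y = true := Nat.find_spec hR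
      have hmin : ∀ e, top < e → e < y → memN D s t₀.val e = true → False := fun e h1 h2 h3 =>
        Nat.find_min hR h2 ⟨h1, by omega, h3⟩
      have hmyF : D.mem s t₀ ⟨y, hy11⟩ = true := by rw [← memN_val]; exact hmy
      -- `y` is uncovered
      have hUy : U.testBit y = true := (h.hU y).2 ⟨by omega, hy11, fun hc => by
        rcases hc with ⟨hle, -⟩ | ⟨t, ht, hm⟩
        · omega
        · exact h.ht₀ (block_unique hK0 hmy hm ▸ ht)⟩
      -- elements of `cur`
      have hcurF : ∀ e, cur.testBit e = true → ∃ he : e < 11, e ≤ top ∧ D.mem s t₀ ⟨e, he⟩ = true := fun e hce => by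
        obtain ⟨hle, hm⟩ := (h.hcur e).1 hce
        exact ⟨by omega, hle, by rw [← memN_val]; exact hm⟩
      -- `addDiffs` succeeds
      obtain ⟨nd, hadd, hnd⟩ := addDiffs_ok cur y Dm
        (fun e he hce => by
          obtain ⟨_, hle, _⟩ := hcurF e hce
          unfold nd1 nd2; omega)
        (fun e he hce => by
          obtain ⟨he', hle, hme⟩ := hcurF e hce
          have hyne : (⟨y, hy11⟩ : Fin 11) ≠ ⟨e, he'⟩ := fun hh => by have := congrArg Fin.val hh; simp at this; omega
          constructor <;> by_contra hc <;> rw [Bool.not_eq_false] at hc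
          · obtain ⟨t, a, a', hne, ha, ha', hca, -, hd⟩ := (h.hDm _).1 hc
            have hd' : a - a' = (⟨y, hy11⟩ : Fin 11) - ⟨e, he'⟩ := Fin.ext (by rw [hd, val_mk_sub]; rfl)
            obtain ⟨rfl, rfl⟩ := internal_unique hI ha ha' hmyF hme hne hd'
            rcases hca with ⟨-, hle'⟩ | hcl
            · simp at hle'; omega
            · exact h.ht₀ hcl
          · obtain ⟨t, a, a', hne, ha, ha', -, hca', hd⟩ := (h.hDm _).1 hc
            have hd' : a - a' = (⟨e, he'⟩ : Fin 11) - ⟨y, hy11⟩ := Fin.ext (by rw [hd, val_mk_sub]; rfl)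
            obtain ⟨rfl, rfl⟩ := internal_unique hI ha ha' hme hmyF hne hd'
            have : a' = ⟨y, hy11⟩ := by
              have := hd'; rw [sub_right_inj] at this; exact this
            subst this
            rcases hca' with ⟨-, hle'⟩ | hcl
            · simp at hle'; omega
            · exact h.ht₀ hcl)
        (fun e e' he he' hce hce' hne => by
          obtain ⟨he1, hle, hme⟩ := hcurF e hce
          obtain ⟨he1', hle', hme'⟩ := hcurF e' hce'
          refine ⟨by unfold nd1; omega, fun hx => ?_, fun hx => ?_, by unfold nd2; omega⟩
          · -- y - e = e' - y
            have hd' : (⟨y, hy11⟩ : Fin 11) - ⟨e, he1⟩ = (⟨e', he1'⟩ : Fin 11) - ⟨y, hy11⟩ :=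
              Fin.ext (by rw [val_mk_sub, val_mk_sub]; exact hx)
            have hne' : (⟨y, hy11⟩ : Fin 11) ≠ ⟨e, he1⟩ := fun hh => by have := congrArg Fin.val hh; simp at this; omega
            have := (internal_unique hI hmyF hme hme' hmyF hne' hd').2
            have := congrArg Fin.val this; simp at this; omega
          · -- e - y = y - e'
            have hd' : (⟨e, he1⟩ : Fin 11) - ⟨y, hy11⟩ = (⟨y, hy11⟩ : Fin 11) - ⟨e', he1'⟩ :=
              Fin.ext (by rw [val_mk_sub, val_mk_sub]; exact hx)
            have hne' : (⟨e, he1⟩ : Fin 11) ≠ ⟨y, hy11⟩ := fun hh => by have := congrArg Fin.val hh; simp at this; omega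
            have := (internal_unique hI hme hmyF hmyF hme' hne' hd').2
            have := congrArg Fin.val this; simp at this; omega)
        11 le_rfl 0 (fun d => by simp)
      -- the new state
      have h' : PInv D s t₀ y CL (U - 2 ^ y) (Dm ||| nd) (cur ||| (1 <<< y)) blocks := by
        refine ⟨⟨hy11, hmy⟩, fun e => ?_, h.ht₀, h.hbl, h.hcl, h.hnd, fun e => ?_, fun d => ?_⟩
        · rw [Nat.testBit_or, Bool.or_eq_true, h.hcur, Nat.testBit_shiftLeft, Bool.and_eq_true, decide_eq_true_eq,
            Nat.testBit_one_eq_true_iff_self_eq_zero]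
          constructor
          · rintro (⟨hle, hm⟩ | ⟨h1, h2⟩)
            · exact ⟨by omega, hm⟩
            · have : e = y := by omega
              subst this; exact ⟨le_rfl, hmy⟩
          · rintro ⟨hle, hm⟩
            by_cases hey : e = y
            · right; omega
            · left; refine ⟨?_, hm⟩
              by_contra hgt
              exact hmin e (by omega) (by omega) hm
        · rw [testBit_sub_two_pow hUy, Bool.and_eq_true, decide_eq_true_eq, h.hU]
          constructor
          · rintro ⟨⟨h1, h2, h3⟩, hey⟩
            refine ⟨h1, h2, fun hc => h3 ?_⟩
            rcases hc with ⟨hle, hm⟩ | hc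
            · left; refine ⟨?_, hm⟩
              by_contra hgt; exact hmin e (by omega) (by omega) hm
            · exact Or.inr hc
          · rintro ⟨h1, h2, h3⟩
            refine ⟨⟨h1, h2, fun hc => h3 ?_⟩, fun hey => h3 (Or.inl ⟨by omega, hey ▸ hmy⟩)⟩
            rcases hc with ⟨hle, hm⟩ | hc
            · exact Or.inl ⟨by omega, hm⟩
            · exact Or.inr hc
        · rw [Nat.testBit_or, Bool.or_eq_true, h.hDm, hnd]
          constructor
          · rintro (⟨t, a, a', hne, ha, ha', hca, hca', hd⟩ | ⟨e, he, hce, hd⟩)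
            · refine ⟨t, a, a', hne, ha, ha', ?_, ?_, hd⟩
              · rcases hca with ⟨ht, hle⟩ | hc
                · exact Or.inl ⟨ht, by omega⟩
                · exact Or.inr hc
              · rcases hca' with ⟨ht, hle⟩ | hc
                · exact Or.inl ⟨ht, by omega⟩
                · exact Or.inr hc
            · obtain ⟨he1, hle, hme⟩ := hcurF e hce
              have hyne : (⟨y, hy11⟩ : Fin 11) ≠ ⟨e, he1⟩ := fun hh => by have := congrArg Fin.val hh; simp at this; omega
              rcases hd with rfl | rfl
              · exact ⟨t₀, ⟨y, hy11⟩, ⟨e, he1⟩, hyne, hmyF, hme, Or.inl ⟨rfl, le_rfl⟩, Or.inl ⟨rfl, by simp; omega⟩,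
                  val_mk_sub hy11 he1⟩
              · exact ⟨t₀, ⟨e, he1⟩, ⟨y, hy11⟩, hyne.symm, hme, hmyF, Or.inl ⟨rfl, by simp; omega⟩, Or.inl ⟨rfl, le_rfl⟩,
                  val_mk_sub he1 hy11⟩
          · rintro ⟨t, a, a', hne, ha, ha', hca, hca', hd⟩
            -- is one of `a`, `a'` the new element `y` of block `t₀`?
            by_cases hay : t = t₀ ∧ a.val = y
            · obtain ⟨rfl, hav⟩ := hay
              right
              have ha'm : memN D s t.val a'.val = true := by rw [memN_val]; exact ha'
              have ha'le : a'.val ≤ top := by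
                rcases hca' with ⟨-, hle⟩ | hc
                · by_contra hgt
                  have hne' : a'.val ≠ y := fun hh => hne (Fin.ext (hav.trans hh.symm))
                  exact hmin a'.val (by omega) (by omega) ha'm
                · exact absurd hc h.ht₀
              refine ⟨a'.val, a'.isLt, (h.hcur _).2 ⟨ha'le, ha'm⟩, Or.inl ?_⟩
              rw [← hd]; unfold nd1
              have := val_sub11'' a a'; rw [hav] at this; exact this
            by_cases hay' : t = t₀ ∧ a'.val = y
            · obtain ⟨rfl, hav'⟩ := hay'
              right
              have ham : memN D s t.val a.val = true := by rw [memN_val]; exact ha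
              have hale : a.val ≤ top := by
                rcases hca with ⟨-, hle⟩ | hc
                · by_contra hgt
                  have hne' : a.val ≠ y := fun hh => hay ⟨rfl, hh⟩
                  exact hmin a.val (by omega) (by omega) ham
                · exact absurd hc h.ht₀
              refine ⟨a.val, a.isLt, (h.hcur _).2 ⟨hale, ham⟩, Or.inr ?_⟩
              rw [← hd]; unfold nd2
              have := val_sub11'' a a'; rw [hav'] at this; exact this
            · left
              refine ⟨t, a, a', hne, ha, ha', ?_, ?_, hd⟩
              · rcases hca with ⟨ht, hle⟩ | hc
                · refine Or.inl ⟨ht, ?_⟩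
                  by_contra hgt
                  have hne' : a.val ≠ y := fun hh => hay ⟨ht, hh⟩
                  exact hmin a.val (by omega) (by omega) (by rw [← ht, memN_val]; exact ha)
                · exact Or.inr hc
              · rcases hca' with ⟨ht, hle⟩ | hc
                · refine Or.inl ⟨ht, ?_⟩
                  by_contra hgt
                  have hne' : a'.val ≠ y := fun hh => hay' ⟨ht, hh⟩
                  exact hmin a'.val (by omega) (by omega) (by rw [← ht, memN_val]; exact ha')
                · exact Or.inr hc
      have hc' : ucard (U - 2 ^ y) < f := by have := ucard_clear hUy hy11; omega
      obtain ⟨bl, hbl, hgood⟩ := pgo_good hK0 hI f t₀ y CL (U - 2 ^ y) (Dm ||| nd) (cur ||| (1 <<< y)) (sz + 1) blocks h' hc'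
      refine ⟨bl, List.mem_append.2 (Or.inr ?_), hgood⟩
      rw [← Nat.one_shiftLeft] at hbl
      exact mem_extLoop hy11 hUy hadd hbl (10 - top) (by omega) (by omega)
    · ----------------------------------------------------------------- the current block is complete: close it
      have hfull : ∀ e, memN D s t₀.val e = true → e ≤ top := fun e he => by
        by_contra hgt
        have he11 : e < 11 := by by_contra hn; rw [memN_of_ge D s (not_lt.1 hn)] at he; exact Bool.false_ne_true he
        exact hR ⟨e, by omega, he11, he⟩
      have hcurE : cur = maskE D s t₀.val := Nat.eq_of_testBit_eq fun e => Bool.eq_iff_iff.2 (by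
        rw [h.hcur, testBit_maskE]; exact ⟨fun h => h.2, fun h => ⟨hfull e h, h⟩⟩)
      have hmask : (cur ||| (sz <<< 11)) &&& 2047 = maskE D s t₀.val := by rw [code_mask (cur_lt h), hcurE]
      have hne0 : maskE D s t₀.val ≠ 0 := fun h0 => by
        have := testBit_maskE D s t₀.val top; rw [h0, Nat.zero_testBit, h.htop.2] at this; exact Bool.false_ne_true this
      have hnotin : maskE D s t₀.val ∉ blocks.map (· &&& 2047) := fun hm => by
        obtain ⟨b, hb, hbe⟩ := List.mem_map.1 hm
        obtain ⟨t, ht, hbt⟩ := h.hbl b hb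
        have : t₀ = t := label_of_maskE_eq hK0 hne0 (hbe.symm.trans hbt)
        exact h.ht₀ (this ▸ ht)
      set closed := cur ||| (sz <<< 11) with hclosed
      by_cases hU0 : U = 0
      · --------------------------------------------------------------- everything is covered: emit
        have hcov : ∀ e, 1 ≤ e → e < 11 → (e ≤ top ∧ memN D s t₀.val e = true) ∨ ∃ t ∈ CL, memN D s t.val e = true := by
          intro e h1 h2; by_contra hn
          have := (h.hU e).2 ⟨h1, h2, hn⟩
          rw [hU0, Nat.zero_testBit] at this; exact Bool.false_ne_true this
        have hcovall : ∀ t : Fin 11, ∀ e, memN D s t.val e = true → t = t₀ ∨ t ∈ CL := fun t e he => by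
          have he11 : e < 11 := by by_contra hn; rw [memN_of_ge D s (not_lt.1 hn)] at he; exact Bool.false_ne_true he
          have he1 : 1 ≤ e := by
            by_contra h0; have : e = 0 := by omega
            subst this; rw [memN_zero hK0] at he; exact Bool.false_ne_true he
          rcases hcov e he1 he11 with ⟨-, hm⟩ | ⟨t', ht', hm⟩
          · exact Or.inl (block_unique hK0 he hm)
          · exact Or.inr (block_unique hK0 he hm ▸ ht')
        have hDm : Dm = 2046 := Nat.eq_of_testBit_eq fun d => Bool.eq_iff_iff.2 (by
          rw [h.hDm, testBit_2046]
          simp only [Bool.and_eq_true, decide_eq_true_eq, Bool.not_eq_true', decide_eq_false_iff_not]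
          constructor
          · rintro ⟨t, a, a', hne, -, -, -, -, hd⟩
            refine ⟨by rw [← hd]; exact (a - a').isLt, fun hd0 => hne ?_⟩
            rw [hd0] at hd
            exact sub_eq_zero.1 (Fin.ext hd)
          · rintro ⟨hd11, hd0⟩
            obtain ⟨t, x, hx, hx', -⟩ := hI ⟨d, hd11⟩ (fun hh => hd0 (congrArg Fin.val hh))
            have hcv : ∀ a : Fin 11, D.mem s t a = true → (t = t₀ ∧ a.val ≤ top) ∨ t ∈ CL := fun a ha => by
              have ham : memN D s t.val a.val = true := by rw [memN_val]; exact ha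
              rcases hcovall t a.val ham with rfl | hc
              · exact Or.inl ⟨rfl, hfull _ ham⟩
              · exact Or.inr hc
            refine ⟨t, x, x - ⟨d, hd11⟩, fun hh => hd0 ?_, hx, hx', hcv x hx, hcv _ hx', by rw [sub_sub_cancel]⟩
            have := congrArg Fin.val (sub_eq_self.1 hh.symm); simpa using this)
        subst hU0
        refine ⟨closed :: blocks, List.mem_append.2 (Or.inl (by rw [hDm]; simp)), ?_, ?_, ?_⟩
        · intro b hb
          rcases List.mem_cons.1 hb with rfl | hb
          · exact ⟨t₀, hmask, hne0⟩
          · obtain ⟨t, ht, hbt⟩ := h.hbl b hb; exact ⟨t, hbt, (h.hcl t ht).2⟩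
        · rw [List.map_cons, List.nodup_cons, hmask]; exact ⟨hnotin, h.hnd⟩
        · intro t ht
          obtain ⟨e, he⟩ := exists_mem_of_maskE_ne_zero' D s ht
          rcases hcovall t e he with rfl | hc
          · exact ⟨closed, by simp, hmask⟩
          · obtain ⟨⟨b, hb, hbt⟩, -⟩ := h.hcl t hc; exact ⟨b, List.mem_cons_of_mem _ hb, hbt⟩
      · --------------------------------------------------------------- open the next block at the least uncovered element
        have hU11 := U_lt h
        obtain ⟨hx11', hbelow', hat⟩ := fz_spec (2047 - U) 11 le_rfl
        obtain ⟨x, hxdef⟩ : ∃ x, fz (2047 - U) 11 = x := ⟨_, rfl⟩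
        rw [hxdef] at hx11' hbelow' hat ⊢
        have hx11 : x < 11 := by
          by_contra hn
          have hx : x = 11 := by omega
          apply hU0; apply Nat.eq_of_testBit_eq; intro i; rw [Nat.zero_testBit]
          by_cases hi : i < 11
          · have := hbelow' i (by omega) (by omega)
            rw [testBit_2047_sub hU11] at this; simpa [hi] using this
          · exact Nat.testBit_lt_two_pow (lt_of_lt_of_le hU11 (Nat.pow_le_pow_right (by norm_num) (by omega)))
        have hUx : U.testBit x = true := by
          have := hat hx11; rw [testBit_2047_sub hU11] at this; simpa [hx11] using this
        have hbelow : ∀ i, i < x → U.testBit i = false := fun i hi => by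
          have := hbelow' i (by omega) hi; rw [testBit_2047_sub hU11] at this; simpa [show i < 11 by omega] using this
        obtain ⟨hx1, -, hncov⟩ := (h.hU x).1 hUx
        obtain ⟨t₁, hxt₁⟩ := exists_block hK0 hx1 hx11
        have ht₁₀ : t₁ ≠ t₀ := fun hh => hncov (Or.inl ⟨hfull x (hh ▸ hxt₁), hh ▸ hxt₁⟩)
        have ht₁C : t₁ ∉ CL := fun hh => hncov (Or.inr ⟨t₁, hh, hxt₁⟩)
        have hlow : ∀ e, memN D s t₁.val e = true → e < x → False := fun e he hex => by
          have he1 : 1 ≤ e := by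
            by_contra h0; have : e = 0 := by omega
            subst this; rw [memN_zero hK0] at he; exact Bool.false_ne_true he
          have := hbelow e hex
          have hn : ¬ (1 ≤ e ∧ e < 11 ∧ ¬((e ≤ top ∧ memN D s t₀.val e = true) ∨ ∃ t ∈ CL, memN D s t.val e = true)) :=
            fun hh => by rw [(h.hU e).2 hh] at this; exact Bool.noConfusion this
          simp only [not_and, not_not] at hn
          rcases hn he1 (by omega) with ⟨-, hm⟩ | ⟨t', ht', hm⟩
          · exact ht₁₀ (block_unique hK0 he hm)
          · exact ht₁C (block_unique hK0 he hm ▸ ht')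
        have h' : PInv D s t₁ x (insert t₀ CL) (U - 2 ^ x) Dm (1 <<< x) (closed :: blocks) := by
          refine ⟨⟨hx11, hxt₁⟩, fun e => ?_, ?_, ?_, ?_, ?_, fun e => ?_, fun d => ?_⟩
          · rw [Nat.testBit_shiftLeft, Bool.and_eq_true, decide_eq_true_eq, Nat.testBit_one_eq_true_iff_self_eq_zero]
            constructor
            · rintro ⟨h1, h2⟩; have : e = x := by omega
              subst this; exact ⟨le_rfl, hxt₁⟩
            · rintro ⟨hle, hm⟩
              have : ¬ e < x := fun hh => hlow e hm hh
              omega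
          · rw [Finset.mem_insert, not_or]; exact ⟨ht₁₀, ht₁C⟩
          · intro b hb
            rcases List.mem_cons.1 hb with rfl | hb
            · exact ⟨t₀, Finset.mem_insert_self _ _, hmask⟩
            · obtain ⟨t, ht, hbt⟩ := h.hbl b hb; exact ⟨t, Finset.mem_insert_of_mem ht, hbt⟩
          · intro t ht
            rcases Finset.mem_insert.1 ht with rfl | ht
            · exact ⟨⟨closed, by simp, hmask⟩, hne0⟩
            · obtain ⟨⟨b, hb, hbt⟩, hne⟩ := h.hcl t ht; exact ⟨⟨b, List.mem_cons_of_mem _ hb, hbt⟩, hne⟩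
          · rw [List.map_cons, List.nodup_cons, hmask]; exact ⟨hnotin, h.hnd⟩
          · rw [testBit_sub_two_pow hUx, Bool.and_eq_true, decide_eq_true_eq, h.hU]
            simp only [Finset.mem_insert, exists_eq_or_imp]
            constructor
            · rintro ⟨⟨h1, h2, h3⟩, hex⟩
              refine ⟨h1, h2, fun hc => ?_⟩
              rcases hc with ⟨hle, hm⟩ | hm | ⟨t, ht, hm⟩
              · exact hex (by have : ¬ e < x := fun hh => hlow e hm hh; omega)
              · exact h3 (Or.inl ⟨hfull e hm, hm⟩)
              · exact h3 (Or.inr ⟨t, ht, hm⟩)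
            · rintro ⟨h1, h2, h3⟩
              refine ⟨⟨h1, h2, fun hc => h3 ?_⟩, fun hex => h3 (Or.inl ⟨le_of_eq hex, hex ▸ hxt₁⟩)⟩
              rcases hc with ⟨-, hm⟩ | ⟨t, ht, hm⟩
              · exact Or.inr (Or.inl hm)
              · exact Or.inr (Or.inr ⟨t, ht, hm⟩)
          · rw [h.hDm]
            simp only [Finset.mem_insert]
            constructor
            · rintro ⟨t, a, a', hne, ha, ha', hca, hca', hd⟩
              refine ⟨t, a, a', hne, ha, ha', ?_, ?_, hd⟩
              · rcases hca with ⟨ht, -⟩ | hc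
                · exact Or.inr (Or.inl ht)
                · exact Or.inr (Or.inr hc)
              · rcases hca' with ⟨ht, -⟩ | hc
                · exact Or.inr (Or.inl ht)
                · exact Or.inr (Or.inr hc)
            · rintro ⟨t, a, a', hne, ha, ha', hca, hca', hd⟩
              have ham : memN D s t.val a.val = true := by rw [memN_val]; exact ha
              have ham' : memN D s t.val a'.val = true := by rw [memN_val]; exact ha'
              have old : ∀ b : Fin 11, memN D s t.val b.val = true → (t = t₀ ∨ t ∈ CL) → (t = t₀ ∧ b.val ≤ top) ∨ t ∈ CL :=
                fun b hb htt => by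
                  rcases htt with rfl | hc
                  · exact Or.inl ⟨rfl, hfull _ hb⟩
                  · exact Or.inr hc
              have htt : t = t₀ ∨ t ∈ CL := by
                rcases hca with ⟨ht1, hle⟩ | htt
                · rcases hca' with ⟨-, hle'⟩ | htt'
                  · exfalso; apply hne; apply Fin.ext
                    have e1 : ¬ a.val < x := fun hh => hlow _ (ht1 ▸ ham) hh
                    have e2 : ¬ a'.val < x := fun hh => hlow _ (ht1 ▸ ham') hh
                    omega
                  · exact htt'
                · exact htt
              exact ⟨t, a, a', hne, ha, ha', old a ham htt, old a' ham' htt, hd⟩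
        have hc' : ucard (U - 2 ^ x) < f := by have := ucard_clear hUx hx11; omega
        obtain ⟨bl, hbl, hgood⟩ := pgo_good hK0 hI f t₁ x (insert t₀ CL) (U - 2 ^ x) Dm (1 <<< x) 1 (closed :: blocks) h' hc'
        refine ⟨bl, List.mem_append.2 (Or.inl ?_), hgood⟩
        have hb : (U == 0) = false := by simpa using hU0
        rw [hb]
        simpa [Nat.one_shiftLeft] using hbl

/-- the initial state of `partsEnum`: block of `1` opened at `1` -/
theorem pinv_init (hK0 : D.PartitionOK s (fun _ => 0) 0) : ∃ t₀ : Fin 11, PInv D s t₀ 1 ∅ 2044 0 2 [] := by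
  obtain ⟨t₀, h1⟩ := exists_block hK0 (le_refl 1) (by norm_num)
  refine ⟨t₀, ⟨by norm_num, h1⟩, fun e => ?_, by simp, by simp, by simp, by simp, fun e => ?_, fun d => ?_⟩
  · rw [show (2 : ℕ) = 2 ^ 1 by norm_num, Nat.testBit_two_pow]
    simp only [decide_eq_true_eq]
    constructor
    · rintro rfl; exact ⟨le_rfl, h1⟩
    · rintro ⟨hle, hm⟩
      rcases Nat.le_one_iff_eq_zero_or_eq_one.1 hle with rfl | rfl
      · rw [memN_zero hK0] at hm; exact absurd hm Bool.false_ne_true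
      · rfl
  · rw [show (2044 : ℕ) = 2 ^ 11 - (3 + 1) by norm_num, Nat.testBit_two_pow_sub_succ (by norm_num),
      show (3 : ℕ) = 2 ^ 2 - 1 by norm_num, Nat.testBit_two_pow_sub_one]
    simp only [Bool.and_eq_true, decide_eq_true_eq, Bool.not_eq_true', decide_eq_false_iff_not, not_lt,
      Finset.notMem_empty, false_and, exists_false, or_false, not_and]
    constructor
    · rintro ⟨h11, h2⟩; exact ⟨by omega, h11, fun hle => by omega⟩
    · rintro ⟨h1', h11, h3⟩
      refine ⟨h11, ?_⟩
      by_contra hlt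
      have : e = 1 := by omega
      subst this
      exact absurd h1 (by simpa using h3 le_rfl)
  · simp only [Nat.zero_testBit, Bool.false_eq_true, Finset.notMem_empty, or_false, false_iff, not_exists, not_and]
    rintro t a a' hne ha ha' ⟨ht, hle⟩ ⟨-, hle'⟩ _
    subst ht
    apply hne; apply Fin.ext
    have m0 := memN_zero hK0 t
    have ha1 : a.val = 1 := by
      rcases Nat.le_one_iff_eq_zero_or_eq_one.1 hle with h0 | h1'
      · rw [← memN_val, h0, m0] at ha; exact absurd ha Bool.false_ne_true
      · exact h1'
    have ha1' : a'.val = 1 := by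
      rcases Nat.le_one_iff_eq_zero_or_eq_one.1 hle' with h0 | h1'
      · rw [← memN_val, h0, m0] at ha'; exact absurd ha' Bool.false_ne_true
      · exact h1'
    rw [ha1, ha1']

/-- **the partition walker lists the blocks of every orbit** -/
theorem exists_blocks (hK0 : D.PartitionOK s (fun _ => 0) 0) (hI : D.InternalOK s) : ∃ bl ∈ partsEnum, GoodBlocks D s bl := by
  obtain ⟨t₀, h⟩ := pinv_init hK0
  have hc : ucard 2044 < 22 := lt_of_le_of_lt (Finset.card_filter_le _ _) (by simp)
  exact pgo_good hK0 hI 22 t₀ 1 ∅ 2044 0 2 1 [] h hc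

/-- **walker soundness, assembled: every row of valid data is among the candidate rows of its packed `φ`** -/
theorem rowCode_mem_rowsFrom (D : TriangleData 11) (hV : D.Valid) (s : Fin 11) :
    rowCode D s ∈ rowsFrom (packPhi D.phi) partsEnum := by
  obtain ⟨hK0, hK1, hK2, hI⟩ := hV.2.1 s
  obtain ⟨bl, hbl, h1, h2, h3⟩ := exists_blocks hK0 hI
  exact rowCode_mem_rowsFrom_of D s (fun t => by unfold dig; exact packPhi_digit D.phi t) hK0 hK1 hK2 h1 h2 h3 partsEnum hbl

end Triangle12

end Summit.Ventures.DiscreteObjects.PP12
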